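import Literature.Probability.LatticeModels.BesselFactorLaplaceBounds
import HarnessLib

/-!
# The sharp logarithm of Fröhlich–Israel–Lieb–Simon's constant for the layered dispersion: `1/6 + (2π)⁻¹ln(1/r) ≤ C(r) ≤ 1 + (2π)⁻¹ln(1/r)`

Topic `Probability/LatticeModels`; sharpens `AnisotropicInfraredConstantBound.lean`
(`AnisotropicRotator.klsConstant_le_sharp`: `C(r) ≤ 1 + π/4 + (π/8)ln(1/r)`, whose docstring records
«the true asymptotics is `C(r) = (2π)⁻¹ln(1/r) + O(1)` [float; not proved]») to the EXACT slope `(2π)⁻¹`,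
two-sided, for Kennedy–Lieb–Shastry's constant `C(r) = (2π)⁻³∫_{[-π,π]³} d³q/E^r_q`,
`E^r_q = 2 − cos q₁ − cos q₂ + r(1 − cos q₃)` (`AnisotropicRotator.klsConstant`):

* `AnisotropicRotator.klsConstant_le_log` — **`C(r) ≤ 1 + (2π)⁻¹ ln(1/r)` for `0 < r ≤ 1`**: three-piece
  estimate of the heat-kernel form `(2π)⁻³∫₀^∞ B(t)²B(rt)dt` (`klsConstant_eq_integral`) split at
  `t = 1`, `t = 1/r`, with the sharp Laplace bounds of `BesselFactorLaplaceBounds.lean`: on `(0,1]`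
  `B(t) ≤ 2π(1 − t + (3/4)t²)`, `B(rt) ≤ 2π`; on `(1,1/r]` `B(t)² ≤ 2πt⁻¹ + (21/5)√(2π)t⁻² + (441/100)t⁻³`,
  `B(rt) ≤ 2π(1 − rt + (3/4)r²t²)` — the main term integrates to `4π² ln(1/r)`, whence the slope; on
  `(1/r, ∞)` the two-term forms of both factors; the constant is then a quadratic in `r` with explicit
  `π`, `√(2π)`-coefficients, bounded using `3.141592 < π < 3.141593`;
* `AnisotropicRotator.klsConstant_ge_log` — **`C(r) ≥ 1/6 + (2π)⁻¹ ln(1/r)`** (`B(u) ≥ 2π(1 − u)` on `(0,1]`,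
  `B(t) ≥ √(2π/t) − (4/(πt))e^{−π²t/2}` on `(1,1/r]`, the last piece dropped), so that
  **`C(r) − (2π)⁻¹ln(1/r) ∈ [1/6, 1]` for all `0 < r ≤ 1`**: the logarithmic law with its exact
  coefficient, two-sided;
* `AnisotropicRotator.layered_longRangeOrder_log` — the interlayer ordering floor of the layered classical XY
  model on `(ℤ/Lℤ)³` with the exact coefficient: for `0 < J⊥ ≤ J∥`, `ε > 0` and all large even `L`,
  plateau `≥ 1 − (1 + (2π)⁻¹ln(J∥/J⊥))/J∥ − ε` — long-range order as soon as **`J∥ > 1 + (2π)⁻¹ln(J∥/J⊥)`**,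
  in temperature units `T_c ≥ J∥/(1 + (2π)⁻¹ln(J∥/J⊥))`, the Hikami–Tsuneto-type logarithm of the
  quasi-two-dimensional literature with its sharp prefactor, for the comparison model (classical rotators;
  nothing here concerns a quantum model or a material). Against `layered_longRangeOrder_explicit_sharp`
  (`J∥ > 1 + π/4 + (π/8)ln(J∥/J⊥)`) the threshold is lower at every anisotropy and has the right slope.

The true constant is `lim_{r→0}(C(r) − (2π)⁻¹ln(1/r)) = (2π)⁻¹ln 32 ≈ 0.5516` and `C(1) ≈ 0.5055`
[float; not proved]; the window `[1/6, 1]` is what the elementary one-dimensional bounds give.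

## References

* J. Fröhlich, R. Israel, E. H. Lieb, B. Simon, Comm. Math. Phys. 62 (1978) 1–34, Thm. 4.7,
  (4.7)–(4.10) [FILS1978].
* T. Kennedy, E. H. Lieb, B. S. Shastry, J. Stat. Phys. 53 (1988) 1019–1030, eq. (7) [KLS1988JSP].
-/

noncomputable section

open MeasureTheory Set Filter
open scoped BigOperators Real Topology

namespace Literature.Probability.LatticeModels

namespace AnisotropicRotator

/-- `√(2π/t) = √(2π)·t^{-1/2}` for `t > 0`. [folklore] -/
private theorem sqrt_two_pi_div {t : ℝ} (ht : 0 < t) :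
    Real.sqrt (2 * π / t) = Real.sqrt (2 * π) * t ^ (-(1 / 2 : ℝ)) := by
  rw [Real.sqrt_div' _ ht.le, Real.sqrt_eq_rpow t, Real.rpow_neg ht.le, div_eq_mul_inv]

/-- `(t^{-1/2})ⁿ = t^{-n/2}` for `t > 0`. [folklore] -/
private theorem rpow_neg_half_pow {t : ℝ} (ht : 0 < t) (n : ℕ) :
    (t ^ (-(1 / 2 : ℝ))) ^ n = t ^ (-(n : ℝ) / 2) := by
  rw [← Real.rpow_natCast, ← Real.rpow_mul ht.le]
  congr 1
  ring

/-! ### `C(r) ≤ 1 + (2π)⁻¹ ln(1/r)` -/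

/-- `∫₀¹ (1 − t + (3/4)t²)² dt = 137/240`. [folklore] -/
private theorem integral_quadratic_sq :
    ∫ t in (0 : ℝ)..1, (1 - t + 3 / 4 * t ^ 2) ^ 2 = 137 / 240 := by
  let Q : ℝ → ℝ := fun t => t - t ^ 2 + 5 / 6 * t ^ 3 - 3 / 8 * t ^ 4 + 9 / 80 * t ^ 5
  have hderiv : deriv Q = fun x => (1 - x + 3 / 4 * x ^ 2) ^ 2 := by
    funext x
    simp (disch := fun_prop) [Q]
    ring
  have hdiff : ∀ x ∈ uIcc (0 : ℝ) 1, DifferentiableAt ℝ Q x := fun x _ => by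
    simp only [Q]
    fun_prop
  rw [intervalIntegral.integral_deriv_eq_sub' Q hderiv hdiff
    (by fun_prop : Continuous fun x : ℝ => (1 - x + 3 / 4 * x ^ 2) ^ 2).continuousOn]
  norm_num [Q]

/-- Piece `(0,1]`: `∫ F ≤ (2π)³·137/240` (`B(t) ≤ 2π(1 − t + (3/4)t²)`, `B(rt) ≤ 2π`). [folklore] -/
private theorem tripleF_piece1 {r : ℝ} (hr : 0 < r)
    (hI : IntegrableOn (fun t => besselFactor t * besselFactor t * besselFactor (t * r)) (Ioc 0 1)) :
    ∫ t in Ioc 0 1, besselFactor t * besselFactor t * besselFactor (t * r) ≤ (2 * π) ^ 3 * (137 / 240) := by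
  have h2π : (0 : ℝ) ≤ 2 * π := by positivity
  have hb1 : ∀ t ∈ Ioc (0 : ℝ) 1, besselFactor t * besselFactor t * besselFactor (t * r) ≤ (2 * π) ^ 3 * (1 - t + 3 / 4 * t ^ 2) ^ 2 := by
    intro t ht
    have hP : 0 ≤ 1 - t + 3 / 4 * t ^ 2 := by nlinarith [sq_nonneg (t - 2 / 3)]
    have h1 := besselFactor_le_quadratic ht.1.le
    have h3 := besselFactor_le_twoPi (mul_nonneg ht.1.le hr.le)
    have hM : 0 ≤ 2 * π * (1 - t + 3 / 4 * t ^ 2) := mul_nonneg h2π hP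
    calc besselFactor t * besselFactor t * besselFactor (t * r)
        ≤ 2 * π * (1 - t + 3 / 4 * t ^ 2) * (2 * π * (1 - t + 3 / 4 * t ^ 2)) * (2 * π) :=
          mul_le_mul (mul_le_mul h1 h1 (zero_le_besselFactor _) hM) h3 (zero_le_besselFactor _)
            (mul_nonneg hM hM)
      _ = (2 * π) ^ 3 * (1 - t + 3 / 4 * t ^ 2) ^ 2 := by ring
  have hcont : Continuous fun t : ℝ => (2 * π) ^ 3 * (1 - t + 3 / 4 * t ^ 2) ^ 2 := by fun_prop
  calc ∫ t in Ioc 0 1, besselFactor t * besselFactor t * besselFactor (t * r)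
      ≤ ∫ t in Ioc (0 : ℝ) 1, (2 * π) ^ 3 * (1 - t + 3 / 4 * t ^ 2) ^ 2 :=
        setIntegral_mono_on hI ((hcont.integrableOn_Icc).mono_set Ioc_subset_Icc_self)
          measurableSet_Ioc hb1
    _ = (2 * π) ^ 3 * (137 / 240) := by
        rw [← intervalIntegral.integral_of_le zero_le_one, intervalIntegral.integral_const_mul,
          integral_quadratic_sq]

/-- Piece `(1,1/r]`: with `R = 1/r`, `∫ F ≤ 4π²ln R − 4π²(1−r) + (3/2)π²(1−r²) + (42π/5)√(2π)(1−r)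
+ (441π/100)(1−r²)` (`B(t)² ≤ 2πt⁻¹ + (21/5)√(2π)t⁻² + (441/100)t⁻³`, `B(rt) ≤ 2π(1 − rt + (3/4)r²t²)`,
`B(rt) ≤ 2π`). [folklore] -/
private theorem tripleF_piece2 {r : ℝ} (hr : 0 < r) (hr1 : r ≤ 1)
    (hI : IntegrableOn (fun t => besselFactor t * besselFactor t * besselFactor (t * r)) (Ioc 1 (1 / r))) :
    ∫ t in Ioc 1 (1 / r), besselFactor t * besselFactor t * besselFactor (t * r) ≤
      4 * π ^ 2 * Real.log (1 / r) - 4 * π ^ 2 * (1 - r) + 3 / 2 * π ^ 2 * (1 - r ^ 2) +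
        42 * π / 5 * Real.sqrt (2 * π) * (1 - r) + 441 * π / 100 * (1 - r ^ 2) := by
  set R : ℝ := 1 / r with hR
  set q : ℝ := Real.sqrt (2 * π) with hq
  have hR1 : 1 ≤ R := by rw [hR, le_div_iff₀ hr]; linarith
  have hR0 : 0 < R := by positivity
  have hRr : R * r = 1 := by rw [hR]; field_simp
  have hRinv : R = r⁻¹ := by rw [hR, one_div]
  have hπ := Real.pi_pos
  have hq0 : 0 ≤ q := Real.sqrt_nonneg _
  have hRpow : ∀ a : ℝ, R ^ a = r ^ (-a) := fun a => by
    rw [hRinv, Real.inv_rpow hr.le, Real.rpow_neg hr.le]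
  -- pointwise
  have hb2 : ∀ t ∈ Ioc (1 : ℝ) R, besselFactor t * besselFactor t * besselFactor (t * r) ≤
      4 * π ^ 2 * t⁻¹ - 4 * π ^ 2 * r + 3 * π ^ 2 * r ^ 2 * t +
        42 * π / 5 * q * t ^ (-(2 : ℝ)) + 441 * π / 50 * t ^ (-(3 : ℝ)) := by
    intro t ht
    have ht1 : 1 ≤ t := ht.1.le
    have ht0 : 0 < t := lt_of_lt_of_le one_pos ht1
    have hu0 : 0 ≤ t * r := (mul_pos ht0 hr).le
    have hu1 : t * r ≤ 1 := by
      have := mul_le_mul_of_nonneg_right ht.2 hr.le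
      rw [hRr] at this
      exact this
    have hsq := besselFactor_sq_le ht1
    rw [← hq] at hsq
    have hBu := besselFactor_le_quadratic hu0
    have hBu' := besselFactor_le_twoPi hu0
    have hB0 := zero_le_besselFactor (t * r)
    set M : ℝ := 2 * π * t ^ (-(1 : ℝ)) with hM
    set E : ℝ := 21 / 5 * q * t ^ (-(2 : ℝ)) + 441 / 100 * t ^ (-(3 : ℝ)) with hE
    have hM0 : 0 ≤ M := by positivity
    have hE0 : 0 ≤ E := by positivity
    have hsqE : besselFactor t * besselFactor t ≤ M + E := by
      have h' : M + E = M + 21 / 5 * q * t ^ (-(2 : ℝ)) + 441 / 100 * t ^ (-(3 : ℝ)) := by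
        rw [hE]; ring
      rw [h']
      exact hsq
    have hstep : besselFactor t * besselFactor t * besselFactor (t * r) ≤ M * (2 * π * (1 - t * r + 3 / 4 * (t * r) ^ 2)) + E * (2 * π) := by
      calc besselFactor t * besselFactor t * besselFactor (t * r)
          ≤ (M + E) * besselFactor (t * r) := mul_le_mul_of_nonneg_right hsqE hB0
        _ = M * besselFactor (t * r) + E * besselFactor (t * r) := by ring
        _ ≤ M * (2 * π * (1 - t * r + 3 / 4 * (t * r) ^ 2)) + E * (2 * π) :=
            add_le_add (mul_le_mul_of_nonneg_left hBu hM0) (mul_le_mul_of_nonneg_left hBu' hE0)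
    have hinv : t ^ (-(1 : ℝ)) = t⁻¹ := Real.rpow_neg_one t
    have halg : M * (2 * π * (1 - t * r + 3 / 4 * (t * r) ^ 2)) + E * (2 * π) =
        4 * π ^ 2 * t⁻¹ - 4 * π ^ 2 * r + 3 * π ^ 2 * r ^ 2 * t +
          42 * π / 5 * q * t ^ (-(2 : ℝ)) + 441 * π / 50 * t ^ (-(3 : ℝ)) := by
      rw [hM, hE, hinv]
      field_simp
      ring
    exact hstep.trans_eq halg
  -- integrals
  have h0R : (0 : ℝ) ∉ uIcc 1 R := by
    rw [uIcc_of_le hR1]; intro h; exact absurd h.1 (by norm_num)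
  have hi_inv : IntervalIntegrable (fun t : ℝ => t⁻¹) volume 1 R :=
    intervalIntegral.intervalIntegrable_inv (fun t ht => by
      rw [uIcc_of_le hR1] at ht; exact ne_of_gt (lt_of_lt_of_le one_pos ht.1)) continuousOn_id
  have hi2 : IntervalIntegrable (fun t : ℝ => t ^ (-(2 : ℝ))) volume 1 R :=
    intervalIntegral.intervalIntegrable_rpow (Or.inr h0R)
  have hi3 : IntervalIntegrable (fun t : ℝ => t ^ (-(3 : ℝ))) volume 1 R :=
    intervalIntegral.intervalIntegrable_rpow (Or.inr h0R)
  have hi_id : IntervalIntegrable (fun t : ℝ => t) volume 1 R :=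
    (by fun_prop : Continuous fun t : ℝ => t).intervalIntegrable _ _
  have hA1 : IntervalIntegrable (fun t : ℝ => 4 * π ^ 2 * t⁻¹) volume 1 R := hi_inv.const_mul _
  have hA2 : IntervalIntegrable (fun t : ℝ => 4 * π ^ 2 * t⁻¹ - 4 * π ^ 2 * r) volume 1 R :=
    hA1.sub intervalIntegrable_const
  have hA3 : IntervalIntegrable (fun t : ℝ => 4 * π ^ 2 * t⁻¹ - 4 * π ^ 2 * r +
      3 * π ^ 2 * r ^ 2 * t) volume 1 R := hA2.add (hi_id.const_mul _)
  have hA4 : IntervalIntegrable (fun t : ℝ => 4 * π ^ 2 * t⁻¹ - 4 * π ^ 2 * r +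
      3 * π ^ 2 * r ^ 2 * t + 42 * π / 5 * q * t ^ (-(2 : ℝ))) volume 1 R :=
    hA3.add (hi2.const_mul _)
  have hA5 : IntervalIntegrable (fun t : ℝ => 4 * π ^ 2 * t⁻¹ - 4 * π ^ 2 * r +
      3 * π ^ 2 * r ^ 2 * t + 42 * π / 5 * q * t ^ (-(2 : ℝ)) + 441 * π / 50 * t ^ (-(3 : ℝ)))
      volume 1 R := hA4.add (hi3.const_mul _)
  have hval : ∫ t in (1 : ℝ)..R, (4 * π ^ 2 * t⁻¹ - 4 * π ^ 2 * r + 3 * π ^ 2 * r ^ 2 * t +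
      42 * π / 5 * q * t ^ (-(2 : ℝ)) + 441 * π / 50 * t ^ (-(3 : ℝ))) =
      4 * π ^ 2 * Real.log R - 4 * π ^ 2 * r * (R - 1) + 3 * π ^ 2 * r ^ 2 * ((R ^ 2 - 1) / 2) +
        42 * π / 5 * q * ((R ^ (-(2 : ℝ) + 1) - 1) / (-(2 : ℝ) + 1)) +
        441 * π / 50 * ((R ^ (-(3 : ℝ) + 1) - 1) / (-(3 : ℝ) + 1)) := by
    rw [intervalIntegral.integral_add hA4 (hi3.const_mul _),
      intervalIntegral.integral_add hA3 (hi2.const_mul _),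
      intervalIntegral.integral_add hA2 (hi_id.const_mul _),
      intervalIntegral.integral_sub hA1 intervalIntegrable_const,
      intervalIntegral.integral_const_mul, intervalIntegral.integral_const_mul,
      intervalIntegral.integral_const_mul, intervalIntegral.integral_const_mul,
      intervalIntegral.integral_const_mul,
      integral_inv_of_pos one_pos hR0, intervalIntegral.integral_const, integral_id,
      integral_rpow (Or.inr ⟨by norm_num, h0R⟩), integral_rpow (Or.inr ⟨by norm_num, h0R⟩)]
    simp only [div_one, one_pow, Real.one_rpow, smul_eq_mul]
    ring
  have hR2 : R ^ (-(2 : ℝ) + 1) = r := by rw [hRpow]; norm_num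
  have hR3 : R ^ (-(3 : ℝ) + 1) = r ^ 2 := by
    rw [hRpow, show (-(-(3 : ℝ) + 1)) = ((2 : ℕ) : ℝ) by norm_num, Real.rpow_natCast]
  have hrR : r * R = 1 := by rw [mul_comm]; exact hRr
  have hrR1 : r * (R - 1) = 1 - r := by linear_combination hrR
  have hrR2 : r ^ 2 * ((R ^ 2 - 1) / 2) = (1 - r ^ 2) / 2 := by
    have h2 : r ^ 2 * R ^ 2 = 1 := by rw [← mul_pow, hrR, one_pow]
    linear_combination (1 / 2 : ℝ) * h2
  calc ∫ t in Ioc 1 R, besselFactor t * besselFactor t * besselFactor (t * r) ≤ ∫ t in Ioc 1 R, (4 * π ^ 2 * t⁻¹ - 4 * π ^ 2 * r +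
        3 * π ^ 2 * r ^ 2 * t + 42 * π / 5 * q * t ^ (-(2 : ℝ)) + 441 * π / 50 * t ^ (-(3 : ℝ))) :=
        setIntegral_mono_on hI ((intervalIntegrable_iff_integrableOn_Ioc_of_le hR1).1 hA5)
          measurableSet_Ioc hb2
    _ = ∫ t in (1 : ℝ)..R, (4 * π ^ 2 * t⁻¹ - 4 * π ^ 2 * r + 3 * π ^ 2 * r ^ 2 * t +
        42 * π / 5 * q * t ^ (-(2 : ℝ)) + 441 * π / 50 * t ^ (-(3 : ℝ))) :=
        (intervalIntegral.integral_of_le hR1).symm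
    _ = _ := hval
    _ = 4 * π ^ 2 * Real.log R - 4 * π ^ 2 * (1 - r) + 3 / 2 * π ^ 2 * (1 - r ^ 2) +
          42 * π / 5 * q * (1 - r) + 441 * π / 100 * (1 - r ^ 2) := by
        rw [hR2, hR3]
        linear_combination (-4 * π ^ 2) * hrR1 + (3 * π ^ 2) * hrR2

/-- Piece `(1/r,∞)`: `∫ F ≤ 4π√(2π) + (4π/3)(21/10) + ((2/3)K√(2π) + (2/5)K(21/10))·r`,
`K = (21/5)√(2π) + 441/100` (the two-term forms of both factors). [folklore] -/
private theorem tripleF_piece3 {r : ℝ} (hr : 0 < r) (hr1 : r ≤ 1)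
    (hI : IntegrableOn (fun t => besselFactor t * besselFactor t * besselFactor (t * r)) (Ioi (1 / r))) :
    ∫ t in Ioi (1 / r), besselFactor t * besselFactor t * besselFactor (t * r) ≤
      4 * π * Real.sqrt (2 * π) + 4 * π * (21 / 10) / 3 +
        2 / 3 * (21 / 5 * Real.sqrt (2 * π) + 441 / 100) * Real.sqrt (2 * π) * r +
        2 / 5 * (21 / 5 * Real.sqrt (2 * π) + 441 / 100) * (21 / 10) * r := by
  set R : ℝ := 1 / r with hR
  set q : ℝ := Real.sqrt (2 * π) with hq
  set γ : ℝ := 21 / 10 with hγ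
  set K : ℝ := 21 / 5 * q + 441 / 100 with hK
  have hR1 : 1 ≤ R := by rw [hR, le_div_iff₀ hr]; linarith
  have hR0 : 0 < R := by positivity
  have hRr : R * r = 1 := by rw [hR]; field_simp
  have hRinv : R = r⁻¹ := by rw [hR, one_div]
  have hπ := Real.pi_pos
  have hq0 : 0 ≤ q := Real.sqrt_nonneg _
  have hK0 : 0 ≤ K := by positivity
  set ρ : ℝ := r ^ (-(1 / 2 : ℝ)) with hρ
  have hρ0 : 0 < ρ := Real.rpow_pos_of_pos hr _
  have hRpow : ∀ a : ℝ, R ^ a = r ^ (-a) := fun a => by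
    rw [hRinv, Real.inv_rpow hr.le, Real.rpow_neg hr.le]
  have hρ3 : ρ ^ 3 = r ^ (-(3 / 2 : ℝ)) := by
    rw [hρ, ← Real.rpow_natCast, ← Real.rpow_mul hr.le]; norm_num
  have hcol1 : ρ * R ^ (-(1 / 2 : ℝ)) = 1 := by
    rw [hRpow, hρ, ← Real.rpow_add hr]; norm_num
  have hcol2 : ρ ^ 3 * R ^ (-(3 / 2 : ℝ)) = 1 := by
    rw [hRpow, hρ3, ← Real.rpow_add hr]; norm_num
  have hcol3 : ρ * R ^ (-(3 / 2 : ℝ)) = r := by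
    rw [hRpow, hρ, ← Real.rpow_add hr]; norm_num
  have hcol4 : ρ ^ 3 * R ^ (-(5 / 2 : ℝ)) = r := by
    rw [hRpow, hρ3, ← Real.rpow_add hr]; norm_num
  -- pointwise
  have hb3 : ∀ t ∈ Ioi R, besselFactor t * besselFactor t * besselFactor (t * r) ≤
      2 * π * q * ρ * t ^ (-(3 / 2 : ℝ)) + 2 * π * γ * ρ ^ 3 * t ^ (-(5 / 2 : ℝ)) +
        K * q * ρ * t ^ (-(5 / 2 : ℝ)) + K * γ * ρ ^ 3 * t ^ (-(7 / 2 : ℝ)) := by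
    intro t ht
    have ht1 : 1 ≤ t := le_trans hR1 (le_of_lt ht)
    have ht0 : 0 < t := lt_of_lt_of_le one_pos ht1
    have hu1 : 1 ≤ t * r := by
      have h := mul_le_mul_of_nonneg_right (le_of_lt ht) hr.le
      rw [hRr] at h
      exact h
    have hu0 : 0 < t * r := mul_pos ht0 hr
    set x : ℝ := t ^ (-(1 / 2 : ℝ)) with hx
    have hx0 : 0 ≤ x := Real.rpow_nonneg ht0.le _
    have hx1 : x ≤ 1 := Real.rpow_le_one_of_one_le_of_nonpos ht1 (by norm_num)
    -- `B(t)² ≤ 2π x² + K x⁴`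
    have hsq := besselFactor_sq_le ht1
    rw [← hq] at hsq
    have hx2 : t ^ (-(1 : ℝ)) = x ^ 2 := by rw [hx, rpow_neg_half_pow ht0 2]; norm_num
    have hx4 : t ^ (-(2 : ℝ)) = x ^ 4 := by rw [hx, rpow_neg_half_pow ht0 4]; norm_num
    have hx6 : t ^ (-(3 : ℝ)) = x ^ 6 := by rw [hx, rpow_neg_half_pow ht0 6]; norm_num
    rw [hx2, hx4, hx6] at hsq
    have hx64 : x ^ 6 ≤ x ^ 4 := by
      have h6 : x ^ 6 = x ^ 4 * x ^ 2 := by ring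
      rw [h6]
      exact mul_le_of_le_one_right (by positivity) (pow_le_one₀ hx0 hx1)
    have hsq' : besselFactor t * besselFactor t ≤ 2 * π * x ^ 2 + K * x ^ 4 := by
      have hKx : K * x ^ 4 = 21 / 5 * q * x ^ 4 + 441 / 100 * x ^ 4 := by rw [hK]; ring
      rw [hKx]
      linarith only [hsq, hx64]
    -- `B(rt) ≤ q ρ x + γ ρ³ x³`
    have hBu := besselFactor_le_two_term hu1
    have hxu : (t * r) ^ (-(1 / 2 : ℝ)) = ρ * x := by
      rw [Real.mul_rpow ht0.le hr.le, hρ, hx]; ring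
    have hBu' : besselFactor (t * r) ≤ q * ρ * x + γ * ρ ^ 3 * x ^ 3 := by
      rw [sqrt_two_pi_div hu0, hxu] at hBu
      have h3 : (t * r) ^ (-(3 / 2 : ℝ)) = (ρ * x) ^ 3 := by
        rw [← hxu, rpow_neg_half_pow hu0 3]; norm_num
      rw [h3] at hBu
      calc besselFactor (t * r) ≤ Real.sqrt (2 * π) * (ρ * x) + 21 / 10 * (ρ * x) ^ 3 := hBu
        _ = q * ρ * x + γ * ρ ^ 3 * x ^ 3 := by rw [hq, hγ]; ring
    have hB0 := zero_le_besselFactor (t * r)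
    have hMpos : 0 ≤ 2 * π * x ^ 2 + K * x ^ 4 := by positivity
    have hstep : besselFactor t * besselFactor t * besselFactor (t * r) ≤ (2 * π * x ^ 2 + K * x ^ 4) * (q * ρ * x + γ * ρ ^ 3 * x ^ 3) :=
      mul_le_mul hsq' hBu' hB0 hMpos
    have hx3 : t ^ (-(3 / 2 : ℝ)) = x ^ 3 := by rw [hx, rpow_neg_half_pow ht0 3]; norm_num
    have hx5 : t ^ (-(5 / 2 : ℝ)) = x ^ 5 := by rw [hx, rpow_neg_half_pow ht0 5]; norm_num
    have hx7 : t ^ (-(7 / 2 : ℝ)) = x ^ 7 := by rw [hx, rpow_neg_half_pow ht0 7]; norm_num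
    rw [hx3, hx5, hx7]
    calc besselFactor t * besselFactor t * besselFactor (t * r) ≤ (2 * π * x ^ 2 + K * x ^ 4) * (q * ρ * x + γ * ρ ^ 3 * x ^ 3) := hstep
      _ = 2 * π * q * ρ * x ^ 3 + 2 * π * γ * ρ ^ 3 * x ^ 5 + K * q * ρ * x ^ 5 +
            K * γ * ρ ^ 3 * x ^ 7 := by ring
  -- integrals
  have hi : ∀ a : ℝ, a < -1 → IntegrableOn (fun t : ℝ => t ^ a) (Ioi R) := fun a ha =>
    integrableOn_Ioi_rpow_of_lt ha hR0
  have hv : ∀ a : ℝ, a < -1 → ∫ t in Ioi R, t ^ a = -R ^ (a + 1) / (a + 1) := fun a ha =>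
    integral_Ioi_rpow_of_lt ha hR0
  have h32 := hi (-(3 / 2 : ℝ)) (by norm_num)
  have h52 := hi (-(5 / 2 : ℝ)) (by norm_num)
  have h72 := hi (-(7 / 2 : ℝ)) (by norm_num)
  have hA1 : IntegrableOn (fun t : ℝ => 2 * π * q * ρ * t ^ (-(3 / 2 : ℝ))) (Ioi R) :=
    h32.const_mul _
  have hA2 : IntegrableOn (fun t : ℝ => 2 * π * q * ρ * t ^ (-(3 / 2 : ℝ)) +
      2 * π * γ * ρ ^ 3 * t ^ (-(5 / 2 : ℝ))) (Ioi R) := hA1.add (h52.const_mul _)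
  have hA3 : IntegrableOn (fun t : ℝ => 2 * π * q * ρ * t ^ (-(3 / 2 : ℝ)) +
      2 * π * γ * ρ ^ 3 * t ^ (-(5 / 2 : ℝ)) + K * q * ρ * t ^ (-(5 / 2 : ℝ))) (Ioi R) :=
    hA2.add (h52.const_mul _)
  have hA4 : IntegrableOn (fun t : ℝ => 2 * π * q * ρ * t ^ (-(3 / 2 : ℝ)) +
      2 * π * γ * ρ ^ 3 * t ^ (-(5 / 2 : ℝ)) + K * q * ρ * t ^ (-(5 / 2 : ℝ)) +
      K * γ * ρ ^ 3 * t ^ (-(7 / 2 : ℝ))) (Ioi R) := hA3.add (h72.const_mul _)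
  have hval : ∫ t in Ioi R, (2 * π * q * ρ * t ^ (-(3 / 2 : ℝ)) +
      2 * π * γ * ρ ^ 3 * t ^ (-(5 / 2 : ℝ)) + K * q * ρ * t ^ (-(5 / 2 : ℝ)) +
      K * γ * ρ ^ 3 * t ^ (-(7 / 2 : ℝ))) =
      2 * π * q * ρ * (-R ^ (-(3 / 2 : ℝ) + 1) / (-(3 / 2 : ℝ) + 1)) +
        2 * π * γ * ρ ^ 3 * (-R ^ (-(5 / 2 : ℝ) + 1) / (-(5 / 2 : ℝ) + 1)) +
        K * q * ρ * (-R ^ (-(5 / 2 : ℝ) + 1) / (-(5 / 2 : ℝ) + 1)) +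
        K * γ * ρ ^ 3 * (-R ^ (-(7 / 2 : ℝ) + 1) / (-(7 / 2 : ℝ) + 1)) := by
    rw [integral_add hA3 (h72.const_mul _), integral_add hA2 (h52.const_mul _),
      integral_add hA1 (h52.const_mul _),
      integral_const_mul, integral_const_mul, integral_const_mul, integral_const_mul,
      hv _ (by norm_num), hv _ (by norm_num), hv _ (by norm_num)]
  have hE1 : -(3 / 2 : ℝ) + 1 = -(1 / 2 : ℝ) := by norm_num
  have hE2 : -(5 / 2 : ℝ) + 1 = -(3 / 2 : ℝ) := by norm_num
  have hE3 : -(7 / 2 : ℝ) + 1 = -(5 / 2 : ℝ) := by norm_num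
  calc ∫ t in Ioi R, besselFactor t * besselFactor t * besselFactor (t * r) ≤ ∫ t in Ioi R, (2 * π * q * ρ * t ^ (-(3 / 2 : ℝ)) +
      2 * π * γ * ρ ^ 3 * t ^ (-(5 / 2 : ℝ)) + K * q * ρ * t ^ (-(5 / 2 : ℝ)) +
      K * γ * ρ ^ 3 * t ^ (-(7 / 2 : ℝ))) := setIntegral_mono_on hI hA4 measurableSet_Ioi hb3
    _ = _ := hval
    _ = 4 * π * q * (ρ * R ^ (-(1 / 2 : ℝ))) + 4 * π * γ / 3 * (ρ ^ 3 * R ^ (-(3 / 2 : ℝ))) +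
          2 / 3 * K * q * (ρ * R ^ (-(3 / 2 : ℝ))) +
          2 / 5 * K * γ * (ρ ^ 3 * R ^ (-(5 / 2 : ℝ))) := by
        rw [hE1, hE2, hE3]
        ring
    _ = 4 * π * q + 4 * π * γ / 3 + 2 / 3 * K * q * r + 2 / 5 * K * γ * r := by
        rw [hcol1, hcol2, hcol3, hcol4]; ring

/-- The numerical heart: the three pieces add up to at most `(2π)³ + 4π² ln(1/r)`, i.e.
`α + βr + γ'r² ≤ 0` with `α ≤ −10.5`, `β ≤ 11`, `γ' ≤ −28` (from `3.141592 < π < 3.141593`,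
`2.5066 < √(2π) < 2.5067`). [folklore] -/
private theorem pieces_sum_le {r : ℝ} (hr : 0 < r) (_hr1 : r ≤ 1) :
    (2 * π) ^ 3 * (137 / 240) +
      (4 * π ^ 2 * Real.log (1 / r) - 4 * π ^ 2 * (1 - r) + 3 / 2 * π ^ 2 * (1 - r ^ 2) +
        42 * π / 5 * Real.sqrt (2 * π) * (1 - r) + 441 * π / 100 * (1 - r ^ 2)) +
      (4 * π * Real.sqrt (2 * π) + 4 * π * (21 / 10) / 3 +
        2 / 3 * (21 / 5 * Real.sqrt (2 * π) + 441 / 100) * Real.sqrt (2 * π) * r +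
        2 / 5 * (21 / 5 * Real.sqrt (2 * π) + 441 / 100) * (21 / 10) * r) ≤
      (2 * π) ^ 3 + 4 * π ^ 2 * Real.log (1 / r) := by
  set q : ℝ := Real.sqrt (2 * π) with hq
  have h2π : (0 : ℝ) ≤ 2 * π := by positivity
  have hq0 : 0 ≤ q := Real.sqrt_nonneg _
  have hqq : q * q = 2 * π := Real.mul_self_sqrt h2π
  have hπlo := Real.pi_gt_d6
  have hπhi := Real.pi_lt_d6
  have hqlo : 2.5066 < q := by
    rw [hq]
    have h : Real.sqrt (2.5066 ^ 2) < Real.sqrt (2 * π) :=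
      Real.sqrt_lt_sqrt (by norm_num) (by norm_num; linarith only [hπlo])
    rwa [Real.sqrt_sq (by norm_num)] at h
  have hqhi : q < 2.5067 := by
    rw [hq]
    have h : Real.sqrt (2 * π) < Real.sqrt (2.5067 ^ 2) :=
      Real.sqrt_lt_sqrt h2π (by norm_num; linarith only [hπhi])
    rwa [Real.sqrt_sq (by norm_num)] at h
  have hπ2lo : 9.869 < π ^ 2 := by nlinarith [hπlo, hπhi]
  have hπ2hi : π ^ 2 < 9.87 := by nlinarith [hπlo, hπhi]
  have hπ3lo : 31.003 < π ^ 3 := by nlinarith [hπlo, hπhi, hπ2lo]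
  have hπqhi : π * q < 7.8751 := by nlinarith [hπlo, hπhi, hqlo, hqhi]
  have hπqlo : 7.8744 < π * q := by nlinarith [hπlo, hπhi, hqlo, hqhi]
  have hα : -(103 / 30) * π ^ 3 - 5 / 2 * π ^ 2 + 62 / 5 * (π * q) + 721 / 100 * π ≤ -10.5 := by
    linarith
  have hβ : 4 * π ^ 2 - 42 / 5 * (π * q) + 28 / 5 * π + 3234 / 500 * q + 37044 / 10000 ≤ 11 := by
    linarith
  have hγ' : -(3 / 2) * π ^ 2 - 441 / 100 * π ≤ -28 := by linarith
  have hquad : (-(103 / 30) * π ^ 3 - 5 / 2 * π ^ 2 + 62 / 5 * (π * q) + 721 / 100 * π) +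
      (4 * π ^ 2 - 42 / 5 * (π * q) + 28 / 5 * π + 3234 / 500 * q + 37044 / 10000) * r +
      (-(3 / 2) * π ^ 2 - 441 / 100 * π) * r ^ 2 ≤ 0 := by
    have h1 : (4 * π ^ 2 - 42 / 5 * (π * q) + 28 / 5 * π + 3234 / 500 * q + 37044 / 10000) * r ≤
        11 * r := mul_le_mul_of_nonneg_right hβ hr.le
    have h2 : (-(3 / 2) * π ^ 2 - 441 / 100 * π) * r ^ 2 ≤ -28 * r ^ 2 :=
      mul_le_mul_of_nonneg_right hγ' (sq_nonneg r)
    nlinarith [sq_nonneg (r - 11 / 56)]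
  have hexp : (2 * π) ^ 3 * (137 / 240) +
      (4 * π ^ 2 * Real.log (1 / r) - 4 * π ^ 2 * (1 - r) + 3 / 2 * π ^ 2 * (1 - r ^ 2) +
        42 * π / 5 * q * (1 - r) + 441 * π / 100 * (1 - r ^ 2)) +
      (4 * π * q + 4 * π * (21 / 10) / 3 + 2 / 3 * (21 / 5 * q + 441 / 100) * q * r +
        2 / 5 * (21 / 5 * q + 441 / 100) * (21 / 10) * r) =
      ((2 * π) ^ 3 + 4 * π ^ 2 * Real.log (1 / r)) +
      ((-(103 / 30) * π ^ 3 - 5 / 2 * π ^ 2 + 62 / 5 * (π * q) + 721 / 100 * π) +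
        (4 * π ^ 2 - 42 / 5 * (π * q) + 28 / 5 * π + 3234 / 500 * q + 37044 / 10000) * r +
        (-(3 / 2) * π ^ 2 - 441 / 100 * π) * r ^ 2) := by
    linear_combination (14 / 5 : ℝ) * r * hqq
  rw [hexp]
  linarith [hquad]

/-- **`C(r) ≤ 1 + (2π)⁻¹ ln(1/r)` for `0 < r ≤ 1`** — the logarithmic bound on Fröhlich–Israel–Lieb–Simon's
constant for Kennedy–Lieb–Shastry's layered dispersion WITH THE SHARP SLOPE `(2π)⁻¹`: split
`∫₀^∞ B(t)²B(rt)dt` at `t = 1` and `t = 1/r`; on `(0,1]` use `B(t) ≤ 2π(1 − t + (3/4)t²)`, `B(rt) ≤ 2π`;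
on `(1,1/r]` use `B(t)² ≤ 2πt⁻¹ + (21/5)√(2π)t⁻² + (441/100)t⁻³` and `B(rt) ≤ 2π(1 − rt + (3/4)r²t²)`
(the main term integrates to `4π² ln(1/r)`, whence the slope); on `(1/r,∞)` the two-term forms of both
factors. [cite: FILS1978, (4.7)] [cite: KLS1988JSP, eq. (7)] -/
theorem klsConstant_le_log {r : ℝ} (hr : 0 < r) (hr1 : r ≤ 1) :
    klsConstant r ≤ 1 + Real.log (1 / r) / (2 * π) := by
  obtain ⟨hI, hrep⟩ := klsConstant_eq_integral hr
  set R : ℝ := 1 / r with hR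
  have hR1 : 1 ≤ R := by rw [hR, le_div_iff₀ hr]; linarith
  have hR0 : 0 < R := by positivity
  have hc : (0 : ℝ) < (2 * π) ^ 3 := by positivity
  have hπ := Real.pi_pos
  have hI1 : IntegrableOn (fun t => besselFactor t * besselFactor t * besselFactor (t * r)) (Ioc 0 1) := hI.mono_set Ioc_subset_Ioi_self
  have hI2 : IntegrableOn (fun t => besselFactor t * besselFactor t * besselFactor (t * r)) (Ioc 1 R) :=
    hI.mono_set (Ioc_subset_Ioi_self.trans (Ioi_subset_Ioi zero_le_one))
  have hI3 : IntegrableOn (fun t => besselFactor t * besselFactor t * besselFactor (t * r)) (Ioi R) := hI.mono_set (Ioi_subset_Ioi hR0.le)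
  have hsplit : ∫ t in Ioi 0, besselFactor t * besselFactor t * besselFactor (t * r) =
      (∫ t in Ioc 0 1, besselFactor t * besselFactor t * besselFactor (t * r)) + (∫ t in Ioc 1 R, besselFactor t * besselFactor t * besselFactor (t * r)) + ∫ t in Ioi R, besselFactor t * besselFactor t * besselFactor (t * r) := by
    rw [← setIntegral_union (Set.Ioc_disjoint_Ioc.2 (by simp [hR1])) measurableSet_Ioc hI1 hI2,
      Set.Ioc_union_Ioc_eq_Ioc zero_le_one hR1,
      ← setIntegral_union (Set.Ioc_disjoint_Ioi (le_refl R)) measurableSet_Ioi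
        (hI.mono_set Ioc_subset_Ioi_self) hI3,
      Set.Ioc_union_Ioi_eq_Ioi hR0.le]
  have hP1 := tripleF_piece1 hr hI1
  have hP2 := tripleF_piece2 hr hr1 hI2
  have hP3 := tripleF_piece3 hr hr1 hI3
  have hsum := pieces_sum_le hr hr1
  have hfin : ∫ t in Ioi 0, besselFactor t * besselFactor t * besselFactor (t * r) ≤ (2 * π) ^ 3 + 4 * π ^ 2 * Real.log (1 / r) := by
    rw [hsplit]
    linarith [hP1, hP2, hP3, hsum]
  rw [hrep]
  calc ((2 * π) ^ 3)⁻¹ * ∫ t in Ioi 0, besselFactor t * besselFactor t * besselFactor (t * r)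
      ≤ ((2 * π) ^ 3)⁻¹ * ((2 * π) ^ 3 + 4 * π ^ 2 * Real.log (1 / r)) :=
        mul_le_mul_of_nonneg_left hfin (inv_nonneg.2 hc.le)
    _ = 1 + Real.log (1 / r) / (2 * π) := by
        field_simp
        ring

/-! ### `C(r) ≥ 1/6 + (2π)⁻¹ ln(1/r)` -/

/-- `∫₀¹ (1 − t)²(1 − rt) dt = 1/3 − r/12`. [folklore] -/
private theorem integral_one_sub_sq_mul (r : ℝ) :
    ∫ t in (0 : ℝ)..1, (1 - t) ^ 2 * (1 - t * r) = 1 / 3 - r / 12 := by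
  let Q : ℝ → ℝ := fun t => t - t ^ 2 + t ^ 3 / 3 - r * (t ^ 2 / 2 - 2 / 3 * t ^ 3 + t ^ 4 / 4)
  have hderiv : deriv Q = fun x => (1 - x) ^ 2 * (1 - x * r) := by
    funext x
    simp (disch := fun_prop) [Q]
    ring
  have hdiff : ∀ x ∈ uIcc (0 : ℝ) 1, DifferentiableAt ℝ Q x := fun x _ => by
    simp only [Q]
    fun_prop
  rw [intervalIntegral.integral_deriv_eq_sub' Q hderiv hdiff
    (by fun_prop : Continuous fun x : ℝ => (1 - x) ^ 2 * (1 - x * r)).continuousOn]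
  norm_num [Q]
  ring

/-- Lower piece `(0,1]`: `∫ F ≥ (2π)³(1/3 − r/12)` (`B(u) ≥ 2π(1 − u)`). [folklore] -/
private theorem tripleF_piece1_ge {r : ℝ} (hr : 0 < r) (hr1 : r ≤ 1)
    (hI : IntegrableOn (fun t => besselFactor t * besselFactor t * besselFactor (t * r)) (Ioc 0 1)) :
    (2 * π) ^ 3 * (1 / 3 - r / 12) ≤ ∫ t in Ioc 0 1, besselFactor t * besselFactor t * besselFactor (t * r) := by
  have h2π : (0 : ℝ) ≤ 2 * π := by positivity
  have hlow : ∀ t ∈ Ioc (0 : ℝ) 1, (2 * π) ^ 3 * ((1 - t) ^ 2 * (1 - t * r)) ≤ besselFactor t * besselFactor t * besselFactor (t * r) := by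
    intro t ht
    have h1 := twoPi_mul_one_sub_le_besselFactor t
    have h2 := twoPi_mul_one_sub_le_besselFactor (t * r)
    have ht1 : 0 ≤ 1 - t := by linarith [ht.2]
    have htr : 0 ≤ 1 - t * r := by nlinarith [ht.1, ht.2]
    have hm1 : 0 ≤ 2 * π * (1 - t) := mul_nonneg h2π ht1
    have hm2 : 0 ≤ 2 * π * (1 - t * r) := mul_nonneg h2π htr
    calc (2 * π) ^ 3 * ((1 - t) ^ 2 * (1 - t * r))
        = 2 * π * (1 - t) * (2 * π * (1 - t)) * (2 * π * (1 - t * r)) := by ring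
      _ ≤ besselFactor t * besselFactor t * besselFactor (t * r) :=
          mul_le_mul (mul_le_mul h1 h1 hm1 (zero_le_besselFactor _)) h2 hm2
            (mul_nonneg (zero_le_besselFactor _) (zero_le_besselFactor _))
  have hcont : Continuous fun t : ℝ => (2 * π) ^ 3 * ((1 - t) ^ 2 * (1 - t * r)) := by fun_prop
  calc (2 * π) ^ 3 * (1 / 3 - r / 12)
      = ∫ t in Ioc (0 : ℝ) 1, (2 * π) ^ 3 * ((1 - t) ^ 2 * (1 - t * r)) := by
        rw [← intervalIntegral.integral_of_le zero_le_one, intervalIntegral.integral_const_mul,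
          integral_one_sub_sq_mul]
    _ ≤ ∫ t in Ioc 0 1, besselFactor t * besselFactor t * besselFactor (t * r) :=
        setIntegral_mono_on ((hcont.integrableOn_Icc).mono_set Ioc_subset_Icc_self) hI
          measurableSet_Ioc hlow

/-- Lower piece `(1,1/r]`: `∫ F ≥ 4π²(ln(1/r) − (1 − r)) − 16√(2π)·e^{−π²/2}/(π²/2)`
(`B(t)² ≥ 2π/t − (8√(2π)/π)e^{−π²t/2}`, `2π(1 − rt) ≤ B(rt) ≤ 2π`). [folklore] -/
private theorem tripleF_piece2_ge {r : ℝ} (hr : 0 < r) (hr1 : r ≤ 1)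
    (hI : IntegrableOn (fun t => besselFactor t * besselFactor t * besselFactor (t * r)) (Ioc 1 (1 / r))) :
    4 * π ^ 2 * (Real.log (1 / r) - (1 - r)) -
        16 * Real.sqrt (2 * π) * (Real.exp (-(π ^ 2 / 2)) / (π ^ 2 / 2)) ≤
      ∫ t in Ioc 1 (1 / r), besselFactor t * besselFactor t * besselFactor (t * r) := by
  set R : ℝ := 1 / r with hR
  set q : ℝ := Real.sqrt (2 * π) with hq
  set c : ℝ := π ^ 2 / 2 with hc
  have hπ := Real.pi_pos
  have hR1 : 1 ≤ R := by rw [hR, le_div_iff₀ hr]; linarith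
  have hR0 : 0 < R := by positivity
  have hRr : R * r = 1 := by rw [hR]; field_simp
  have hc0 : 0 < c := by positivity
  have hq0 : 0 ≤ q := Real.sqrt_nonneg _
  have h2π : (0 : ℝ) ≤ 2 * π := by positivity
  -- pointwise
  have hlow : ∀ t ∈ Ioc (1 : ℝ) R,
      4 * π ^ 2 * t⁻¹ - 4 * π ^ 2 * r - 16 * q * Real.exp (-c * t) ≤ besselFactor t * besselFactor t * besselFactor (t * r) := by
    intro t ht
    have ht1 : 1 ≤ t := ht.1.le
    have ht0 : 0 < t := lt_of_lt_of_le one_pos ht1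
    have hu1 : t * r ≤ 1 := by
      have := mul_le_mul_of_nonneg_right ht.2 hr.le
      rw [hRr] at this
      exact this
    -- `B(t)² ≥ 2π/t − (8q/π) e^{-ct}`
    have hL := besselFactor_ge_gaussian ht0
    set a : ℝ := Real.sqrt (2 * π / t) with ha
    set b : ℝ := 4 / (π * t) * Real.exp (-(π ^ 2 * t / 2)) with hb
    have ha0 : 0 ≤ a := Real.sqrt_nonneg _
    have hb0 : 0 ≤ b := by positivity
    have haa : a * a = 2 * π / t := Real.mul_self_sqrt (by positivity)
    have ha1 : a ≤ q := by
      rw [ha, hq]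
      exact Real.sqrt_le_sqrt (div_le_self h2π ht1)
    have hb1 : b ≤ 4 / π * Real.exp (-c * t) := by
      have he : Real.exp (-(π ^ 2 * t / 2)) = Real.exp (-c * t) := by rw [hc]; ring_nf
      rw [hb, he]
      refine mul_le_mul_of_nonneg_right ?_ (Real.exp_pos _).le
      exact div_le_div_of_nonneg_left (by norm_num) hπ (le_mul_of_one_le_right hπ.le ht1)
    have hB0 := zero_le_besselFactor t
    have hsq : 2 * π / t - 8 * q / π * Real.exp (-c * t) ≤ besselFactor t * besselFactor t := by
      have hab4 : a * b ≤ q * (4 / π * Real.exp (-c * t)) := mul_le_mul ha1 hb1 hb0 hq0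
      have h8 : 8 * q / π * Real.exp (-c * t) = 2 * (q * (4 / π * Real.exp (-c * t))) := by ring
      have hmain : 2 * π / t - 8 * q / π * Real.exp (-c * t) ≤ a * a - 2 * (a * b) := by
        rw [h8, ← haa]
        linarith [hab4]
      rcases le_or_gt a b with hle' | hlt'
      · -- `a ≤ b`: the left side is `≤ a(a - 2b) ≤ 0 ≤ B²`
        have h1 : a * a ≤ a * b := mul_le_mul_of_nonneg_left hle' ha0
        have h2 : a * a - 2 * (a * b) ≤ 0 := by linarith [mul_nonneg ha0 hb0]
        linarith [mul_nonneg hB0 hB0]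
      · have hpos : 0 ≤ a - b := by linarith
        have hab : a - b ≤ besselFactor t := hL
        have h1 : (a - b) * (a - b) ≤ besselFactor t * besselFactor t :=
          mul_le_mul hab hab hpos hB0
        have hexpand : (a - b) * (a - b) = a * a - 2 * (a * b) + b * b := by ring
        linarith [mul_nonneg hb0 hb0]
    -- `2π(1 − tr) ≤ B(tr) ≤ 2π`
    have hm := twoPi_mul_one_sub_le_besselFactor (t * r)
    have hM := besselFactor_le_twoPi (by positivity : 0 ≤ t * r)
    have hBu0 := zero_le_besselFactor (t * r)
    have he0 : 0 ≤ 8 * q / π * Real.exp (-c * t) := by positivity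
    have ht' : 0 ≤ 2 * π / t := by positivity
    calc 4 * π ^ 2 * t⁻¹ - 4 * π ^ 2 * r - 16 * q * Real.exp (-c * t)
        = 2 * π / t * (2 * π * (1 - t * r)) - 8 * q / π * Real.exp (-c * t) * (2 * π) := by
          field_simp
          ring
      _ ≤ 2 * π / t * besselFactor (t * r) - 8 * q / π * Real.exp (-c * t) * besselFactor (t * r) := by
          have h1 := mul_le_mul_of_nonneg_left hm ht'
          have h2 := mul_le_mul_of_nonneg_left hM he0
          linarith
      _ = (2 * π / t - 8 * q / π * Real.exp (-c * t)) * besselFactor (t * r) := by ring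
      _ ≤ besselFactor t * besselFactor t * besselFactor (t * r) :=
          mul_le_mul_of_nonneg_right hsq hBu0
  -- integrals
  have hi_inv : IntervalIntegrable (fun t : ℝ => t⁻¹) volume 1 R :=
    intervalIntegral.intervalIntegrable_inv (fun t ht => by
      rw [uIcc_of_le hR1] at ht; exact ne_of_gt (lt_of_lt_of_le one_pos ht.1)) continuousOn_id
  have hie : IntervalIntegrable (fun t : ℝ => Real.exp (-c * t)) volume 1 R :=
    (by fun_prop : Continuous fun t : ℝ => Real.exp (-c * t)).intervalIntegrable _ _
  have hA1 : IntervalIntegrable (fun t : ℝ => 4 * π ^ 2 * t⁻¹) volume 1 R := hi_inv.const_mul _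
  have hA2 : IntervalIntegrable (fun t : ℝ => 4 * π ^ 2 * t⁻¹ - 4 * π ^ 2 * r) volume 1 R :=
    hA1.sub intervalIntegrable_const
  have hA3 : IntervalIntegrable (fun t : ℝ => 4 * π ^ 2 * t⁻¹ - 4 * π ^ 2 * r -
      16 * q * Real.exp (-c * t)) volume 1 R := hA2.sub (hie.const_mul _)
  have hexp_le : ∫ t in (1 : ℝ)..R, Real.exp (-c * t) ≤ Real.exp (-c) / c := by
    have hIoi := integrableOn_exp_mul_Ioi (by linarith : -c < 0) 1
    calc ∫ t in (1 : ℝ)..R, Real.exp (-c * t) = ∫ t in Ioc 1 R, Real.exp (-c * t) :=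
          intervalIntegral.integral_of_le hR1
      _ ≤ ∫ t in Ioi 1, Real.exp (-c * t) :=
          setIntegral_mono_set hIoi (Eventually.of_forall fun t => (Real.exp_pos _).le)
            (Eventually.of_forall Ioc_subset_Ioi_self)
      _ = -Real.exp (-c * 1) / (-c) := integral_exp_mul_Ioi (by linarith) 1
      _ = Real.exp (-c) / c := by rw [mul_one, neg_div_neg_eq]
  have hval : ∫ t in (1 : ℝ)..R, (4 * π ^ 2 * t⁻¹ - 4 * π ^ 2 * r - 16 * q * Real.exp (-c * t)) =
      4 * π ^ 2 * Real.log R - (R - 1) * (4 * π ^ 2 * r) - 16 * q * ∫ t in (1 : ℝ)..R, Real.exp (-c * t) := by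
    rw [intervalIntegral.integral_sub hA2 (hie.const_mul _),
      intervalIntegral.integral_sub hA1 intervalIntegrable_const,
      intervalIntegral.integral_const_mul, intervalIntegral.integral_const_mul,
      intervalIntegral.integral_const_mul,
      integral_inv_of_pos one_pos hR0, intervalIntegral.integral_const]
    simp only [div_one, smul_eq_mul]
    ring
  have hrR1 : (R - 1) * (4 * π ^ 2 * r) = 4 * π ^ 2 * (1 - r) := by
    have : r * R = 1 := by rw [mul_comm]; exact hRr
    linear_combination (4 * π ^ 2) * this
  calc 4 * π ^ 2 * (Real.log R - (1 - r)) - 16 * q * (Real.exp (-c) / c)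
      ≤ 4 * π ^ 2 * Real.log R - (R - 1) * (4 * π ^ 2 * r) -
          16 * q * ∫ t in (1 : ℝ)..R, Real.exp (-c * t) := by
        rw [hrR1]
        have := mul_le_mul_of_nonneg_left hexp_le (by positivity : (0 : ℝ) ≤ 16 * q)
        linarith
    _ = ∫ t in (1 : ℝ)..R, (4 * π ^ 2 * t⁻¹ - 4 * π ^ 2 * r - 16 * q * Real.exp (-c * t)) := hval.symm
    _ = ∫ t in Ioc 1 R, (4 * π ^ 2 * t⁻¹ - 4 * π ^ 2 * r - 16 * q * Real.exp (-c * t)) :=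
        intervalIntegral.integral_of_le hR1
    _ ≤ ∫ t in Ioc 1 R, besselFactor t * besselFactor t * besselFactor (t * r) :=
        setIntegral_mono_on ((intervalIntegrable_iff_integrableOn_Ioc_of_le hR1).1 hA3) hI
          measurableSet_Ioc hlow

/-- **`C(r) ≥ 1/6 + (2π)⁻¹ ln(1/r)` for `0 < r ≤ 1`** — the lower companion of `klsConstant_le_log`, so
that `C(r) = (2π)⁻¹ln(1/r) + O(1)` with `O(1) ∈ [1/6, 1]`: drop `(1/r, ∞)`, use `B(u) ≥ 2π(1 − u)` on
`(0,1]` and `B(t)² ≥ 2π/t − (8√(2π)/π)e^{−π²t/2}`, `B(rt) ≥ 2π(1 − rt)` on `(1, 1/r]`.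
[cite: FILS1978, (4.7)] [cite: KLS1988JSP, eq. (7)] -/
theorem klsConstant_ge_log {r : ℝ} (hr : 0 < r) (hr1 : r ≤ 1) :
    1 / 6 + Real.log (1 / r) / (2 * π) ≤ klsConstant r := by
  obtain ⟨hI, hrep⟩ := klsConstant_eq_integral hr
  set R : ℝ := 1 / r with hR
  have hR1 : 1 ≤ R := by rw [hR, le_div_iff₀ hr]; linarith
  have hR0 : 0 < R := by positivity
  have hc : (0 : ℝ) < (2 * π) ^ 3 := by positivity
  have hπ := Real.pi_pos
  have hI1 : IntegrableOn (fun t => besselFactor t * besselFactor t * besselFactor (t * r)) (Ioc 0 1) := hI.mono_set Ioc_subset_Ioi_self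
  have hI2 : IntegrableOn (fun t => besselFactor t * besselFactor t * besselFactor (t * r)) (Ioc 1 R) :=
    hI.mono_set (Ioc_subset_Ioi_self.trans (Ioi_subset_Ioi zero_le_one))
  have hI3 : IntegrableOn (fun t => besselFactor t * besselFactor t * besselFactor (t * r)) (Ioi R) := hI.mono_set (Ioi_subset_Ioi hR0.le)
  have hsplit : ∫ t in Ioi 0, besselFactor t * besselFactor t * besselFactor (t * r) =
      (∫ t in Ioc 0 1, besselFactor t * besselFactor t * besselFactor (t * r)) + (∫ t in Ioc 1 R, besselFactor t * besselFactor t * besselFactor (t * r)) + ∫ t in Ioi R, besselFactor t * besselFactor t * besselFactor (t * r) := by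
    rw [← setIntegral_union (Set.Ioc_disjoint_Ioc.2 (by simp [hR1])) measurableSet_Ioc hI1 hI2,
      Set.Ioc_union_Ioc_eq_Ioc zero_le_one hR1,
      ← setIntegral_union (Set.Ioc_disjoint_Ioi (le_refl R)) measurableSet_Ioi
        (hI.mono_set Ioc_subset_Ioi_self) hI3,
      Set.Ioc_union_Ioi_eq_Ioi hR0.le]
  have hP3 : 0 ≤ ∫ t in Ioi R, besselFactor t * besselFactor t * besselFactor (t * r) :=
    setIntegral_nonneg measurableSet_Ioi fun t _ =>
      mul_nonneg (mul_nonneg (zero_le_besselFactor _) (zero_le_besselFactor _)) (zero_le_besselFactor _)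
  have hP1 := tripleF_piece1_ge hr hr1 hI1
  have hP2 := tripleF_piece2_ge hr hr1 hI2
  -- numerics
  set q : ℝ := Real.sqrt (2 * π) with hq
  have h2π : (0 : ℝ) ≤ 2 * π := by positivity
  have hπhi := Real.pi_lt_d2
  have hπlo := Real.pi_gt_d2
  have hqhi : q ≤ 2.51 := by
    rw [hq]
    have h : Real.sqrt (2 * π) ≤ Real.sqrt (2.51 ^ 2) := Real.sqrt_le_sqrt (by nlinarith)
    rwa [Real.sqrt_sq (by norm_num)] at h
  have hexp : Real.exp (-(π ^ 2 / 2)) / (π ^ 2 / 2) ≤ 0.012 := by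
    have hx : (0 : ℝ) ≤ π ^ 2 / 2 := by positivity
    have h1 := Real.quadratic_le_exp_of_nonneg hx
    have hpos : 0 < 1 + π ^ 2 / 2 + (π ^ 2 / 2) ^ 2 / 2 := by positivity
    have h2 : Real.exp (-(π ^ 2 / 2)) ≤ (1 + π ^ 2 / 2 + (π ^ 2 / 2) ^ 2 / 2)⁻¹ := by
      rw [Real.exp_neg]
      exact inv_anti₀ hpos h1
    have h3 : (1 + π ^ 2 / 2 + (π ^ 2 / 2) ^ 2 / 2)⁻¹ ≤ 0.056 := by
      rw [inv_le_comm₀ hpos (by norm_num)]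
      nlinarith
    rw [div_le_iff₀ (by positivity)]
    nlinarith [h2, h3]
  have hfin : (2 * π) ^ 3 * (1 / 6 + Real.log (1 / r) / (2 * π)) ≤ ∫ t in Ioi 0, besselFactor t * besselFactor t * besselFactor (t * r) := by
    rw [hsplit]
    have hkey : (2 * π) ^ 3 * (1 / 6 + Real.log (1 / r) / (2 * π)) ≤
        (2 * π) ^ 3 * (1 / 3 - r / 12) + (4 * π ^ 2 * (Real.log (1 / r) - (1 - r)) -
          16 * q * (Real.exp (-(π ^ 2 / 2)) / (π ^ 2 / 2))) := by
      have hlog : (2 * π) ^ 3 * (1 / 6 + Real.log (1 / r) / (2 * π)) =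
          (2 * π) ^ 3 / 6 + 4 * π ^ 2 * Real.log (1 / r) := by
        field_simp
        ring
      rw [hlog]
      have h16 : 16 * q * (Real.exp (-(π ^ 2 / 2)) / (π ^ 2 / 2)) ≤ 16 * 2.51 * 0.012 := by
        have := Real.sqrt_nonneg (2 * π)
        exact mul_le_mul (by nlinarith) hexp (by positivity) (by norm_num)
      have hr2 : 0 ≤ 1 - r / 2 := by linarith
      have hr3 : 0 ≤ 1 - r := by linarith
      have hπ2hi : π ^ 2 ≤ 9.9225 := by nlinarith
      have hπ3lo : 30.959 ≤ π ^ 3 := by nlinarith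
      have hA : 30.959 * (1 - r / 2) ≤ π ^ 3 * (1 - r / 2) := mul_le_mul_of_nonneg_right hπ3lo hr2
      have hB : π ^ 2 * (1 - r) ≤ 9.9225 * (1 - r) := mul_le_mul_of_nonneg_right hπ2hi hr3
      nlinarith [hA, hB, h16, hr, hr1]
    linarith [hP1, hP2, hP3, hkey]
  rw [hrep]
  calc 1 / 6 + Real.log (1 / r) / (2 * π)
      = ((2 * π) ^ 3)⁻¹ * ((2 * π) ^ 3 * (1 / 6 + Real.log (1 / r) / (2 * π))) := by
        field_simp
    _ ≤ ((2 * π) ^ 3)⁻¹ * ∫ t in Ioi 0, besselFactor t * besselFactor t * besselFactor (t * r) :=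
        mul_le_mul_of_nonneg_left hfin (inv_nonneg.2 hc.le)

/-! ### The interlayer ordering floor with the sharp coefficient -/

/-- **The interlayer ordering floor with the exact logarithm**: for `0 < J⊥ ≤ J∥` and `ε > 0`, for all
large even `L`, the layered classical XY model on `(ℤ/Lℤ)³` has
`L⁻⁶∑_{x,y}⟨cos(θ_x − θ_y)⟩_{(J∥,J∥,J⊥)} ≥ 1 − (1 + (2π)⁻¹ln(J∥/J⊥))/J∥ − ε` — long-range order as soon as
`J∥ > 1 + (2π)⁻¹ ln(J∥/J⊥)`; in temperature units `T_c ≥ J∥,phys/(1 + (2π)⁻¹ln(J∥/J⊥))`, the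
Hikami–Tsuneto-type logarithm with its sharp prefactor, for the comparison model (Fröhlich–Israel–Lieb–Simon's
criterion with `C₀ ≤ 1 + (2π)⁻¹ln(J∥/J⊥)`). [cite: FILS1978, Thm. 4.7 with (4.7)–(4.10)] [cite: KLS1988JSP, eqs. (5)–(7)] -/
theorem layered_longRangeOrder_log {Jpar Jperp : ℝ} (hperp : 0 < Jperp) (hle : Jperp ≤ Jpar)
    {ε : ℝ} (hε : 0 < ε) :
    ∃ L₀ : ℕ, ∀ (L : ℕ) [NeZero L], L₀ ≤ L → Even L → 4 ≤ L →
      1 - (1 + Real.log (Jpar / Jperp) / (2 * π)) / Jpar - ε ≤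
        plateau L (layeredCoupling Jpar Jperp) := by
  have hpar : 0 < Jpar := hperp.trans_le hle
  obtain ⟨L₀, hL₀⟩ := layered_longRangeOrder_infraredBound hpar hperp hε
  refine ⟨L₀, fun L _ hL hLe hL4 => ?_⟩
  have h := hL₀ L hL hLe hL4
  have hC : klsConstant (Jperp / Jpar) ≤ 1 + Real.log (Jpar / Jperp) / (2 * π) := by
    have h1 := klsConstant_le_log (div_pos hperp hpar) ((div_le_one hpar).2 hle)
    rwa [one_div_div] at h1
  have hdiv : klsConstant (Jperp / Jpar) / Jpar ≤ (1 + Real.log (Jpar / Jperp) / (2 * π)) / Jpar :=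
    div_le_div_of_nonneg_right hC hpar.le
  linarith

end AnisotropicRotator

end Literature.Probability.LatticeModels
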